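import Literature.AlgebraicGeometry.Resolution.ExceptionalDivisorRegularGlobal
import Literature.AlgebraicGeometry.Resolution.ExceptionalDivisorProjectiveBundleAffine
import Literature.AlgebraicGeometry.Resolution.AffineBlowupIntegral
import Literature.AlgebraicGeometry.Resolution.ComponentGluing
import Literature.AlgebraicGeometry.Resolution.NormalCrossingsLocal
import HarnessLib

/-!
# The exceptional divisor of the blowing up of a regular scheme along a regular irreducible centre is irreducible
# (Liu, Thm. 8.1.19 (b): `E = π⁻¹(Y)` is a projective bundle over `Y`)

Topic: `Literature/AlgebraicGeometry/Resolution`. PROVED over the tree. Q. Liu, *Algebraic Geometry and Arithmetic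
Curves*, OUP 2002, §8.1 Thm. 1.19 (b) (PDF p. 383 of the held copy): for the blowing-up `π : X̃ → X` of a regular
locally Noetherian scheme `X` along a regular closed subscheme `Y`, «the scheme `E := π⁻¹(Y)` is a projective bundle
`ℙ(C_{Y/X})` of rank `codim(Y, X) − 1` over `Y`». The tree has the regularity of `E` (`ExceptionalDivisorRegularGlobal`)
and the AFFINE form of the bundle statement (`exists_iso_pullback_proj_of_isQuasiRegular`: over an affine open `V` on
which the ideal of `Y` is generated by a quasi-regular sequence `x₀, …, xₙ`, `E|_V ≅ ℙⁿ_{Γ(Y ∩ V)}`). This file draws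
the consequence used when a centre of a later blow-up is placed inside an exceptional divisor (Hironaka 2017 §3.3,
the type-(I)/(II) towers: `H(j+1) = π(j)⁻¹ D(j)` must have a generic point): **if moreover `Y` is irreducible and
nowhere dense, then `E = π⁻¹(Y)` is irreducible.**

Proof. Pieces: for `x ∈ Y` choose an affine `V ∋ x` as above (`exists_isQuasiRegular_away_of_isRegularRing`; at
least one generator because `Y` is nowhere dense). Then `E ∩ π⁻¹V` is the continuous image of
`ℙⁿ_{Γ(Y ∩ V)} = Proj Γ(Y∩V)[T₀,…,Tₙ]`, and `Γ(Y ∩ V)` is a domain (`Y ∩ V` is a non-empty open of the integral scheme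
`Y_red`), so the piece is irreducible (`Proj.irreducibleSpace`); and `E ∩ π⁻¹V → Y ∩ V` is surjective because
`ℙⁿ_R → Spec R` is (the chart `D₊(T₀) = 𝔸ⁿ_R` has the zero section). Gluing: every `V` as above contains the generic
point `η` of `Y`, so every piece meets the piece through a fixed `x₀ ∈ Y` inside the fibre over `η`; a non-empty open
subset of an irreducible piece is dense in it, hence `E` is the closure of the single irreducible piece
`E ∩ π⁻¹V_{x₀}`, and closures of irreducible sets are irreducible.

* (private) `toSpec_surjective` — `ℙⁿ_R → Spec R` is surjective (any commutative ring `R`);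
  `irreducibleSpace_proj_mvPolynomial` — `ℙⁿ_R` is irreducible for a domain `R`;
* `exists_affineOpen_isQuasiRegular_of_mem_support` — local quasi-regular generators of a regular centre in a regular
  scheme (packaging of `exists_isQuasiRegular_away_of_isRegularRing` for ideal sheaves);
* `IsBlowup.isIrreducible_preimage_inter_and_surjOn` — one affine piece of `E` is irreducible and maps onto `D ∩ V`;
* `IsBlowup.isIrreducible_preimage_of_isRegular` — **the theorem**.

## Sources
* Q. Liu, *Algebraic Geometry and Arithmetic Curves*, OUP 2002, §8.1 Thm. 1.19 (b) (PDF p. 383). [Liu2002]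
* R. Hartshorne, *Algebraic Geometry* (1977), II Thm. 8.24 (b). [Hartshorne1977]
-/

noncomputable section

open CategoryTheory CategoryTheory.Limits AlgebraicGeometry TopologicalSpace Opposite
open HomogeneousLocalization
open Literature.AlgebraicGeometry.Motives Literature.AlgebraicGeometry.Motives.Segre

attribute [local instance] MvPolynomial.gradedAlgebra ProjBaseChange.algebraBase

namespace Literature.AlgebraicGeometry.Resolution

universe u

/-! ## `ℙⁿ_R → Spec R` is surjective; `ℙⁿ_R` is irreducible for a domain `R` -/

/-- **`ℙⁿ_R → Spec R` is surjective** for every commutative ring `R`: the standard chart `D₊(T₀) = Spec R[T₁/T₀, …]`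
admits the section `T_j/T₀ ↦ 0` of its structure map. [folklore] -/
private theorem toSpec_surjective (k : Type u) [CommRing k] (n : ℕ) :
    Function.Surjective (toSpec (Fin (n + 1)) k) := by
  classical
  -- the evaluation `T_j/T₀ ↦ 0`, a retraction of the structure map `cst` of the chart ring
  let ρ : Away (grading (Fin (n + 1)) k) (MvPolynomial.X 0) →+* k :=
    (MvPolynomial.aeval (fun _ : Fin n => (0 : k))).toRingHom.comp
      (ProjectiveSpace.chartAlgEquiv k (0 : Fin (n + 1))).toAlgHom.toRingHom
  have hρ : ρ.comp (cst k (MvPolynomial.X 0)) = RingHom.id k := by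
    ext c
    change MvPolynomial.aeval (fun _ : Fin n => (0 : k))
      (ProjectiveSpace.chartAlgEquiv k (0 : Fin (n + 1)) (cst k (MvPolynomial.X 0) c)) = c
    rw [← algebraMap_away_eq_cst, AlgEquiv.commutes, AlgHom.commutes, Algebra.algebraMap_self, RingHom.id_apply]
  intro p
  refine ⟨chartι k (0 : Fin (n + 1)) (Spec.map (CommRingCat.ofHom ρ) p), ?_⟩
  rw [← Scheme.Hom.comp_apply, chartι_toSpec, ← Scheme.Hom.comp_apply, ← Spec.map_comp,
    ← CommRingCat.ofHom_comp, hρ, CommRingCat.ofHom_id, Spec.map_id]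
  rfl

/-- **`ℙⁿ_R = Proj R[T₀, …, Tₙ]` is irreducible for a domain `R`** (`Proj` of a graded domain with non-zero
irrelevant ideal). [folklore] -/
private theorem irreducibleSpace_proj_mvPolynomial (R : Type u) [CommRing R] [IsDomain R] (n : ℕ) :
    IrreducibleSpace (Proj (grading (Fin (n + 1)) R)) := by
  refine Proj.irreducibleSpace (grading (Fin (n + 1)) R) ?_
  intro h
  have hx : (MvPolynomial.X 0 : MvPolynomial (Fin (n + 1)) R) ∈
      (HomogeneousIdeal.irrelevant (grading (Fin (n + 1)) R)).toIdeal :=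
    HomogeneousIdeal.mem_irrelevant_of_mem _ zero_lt_one (X_mem R 0)
  rw [h] at hx
  exact MvPolynomial.X_ne_zero 0 ((Submodule.mem_bot _).1 hx)

/-! ## Local quasi-regular generators of a regular centre in a regular scheme -/

/-- **Local structure of a regular centre in a regular locally Noetherian scheme, for ideal sheaves**: at a point
`x` of `V(J)` there is an affine open `V ∋ x` on which `J` is generated (on global sections of `V`) by a
quasi-regular sequence (`exists_isQuasiRegular_away_of_isRegularRing` on an affine neighbourhood, restricted to a
basic open). [cite: Liu2002, Thm. 8.1.19 (proof)] -/
theorem exists_affineOpen_isQuasiRegular_of_mem_support {X : Scheme.{u}} [IsLocallyNoetherian X]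
    (hX : Scheme.IsRegular X) {J : X.IdealSheafData} (hY : Scheme.IsRegular J.subscheme) {x : X}
    (hxs : x ∈ J.support) :
    ∃ (V : X.Opens) (hV : IsAffineOpen V), x ∈ V ∧ ∃ (c : ℕ) (f : Fin c → Γ((V : Scheme.{u}), ⊤)),
      (J.comap V.ι).ideal ⟨⊤, @isAffineOpen_top (V : Scheme.{u}) hV⟩ = Ideal.span (Set.range f) ∧
        IsQuasiRegular f := by
  -- an affine open `W ∋ x`
  obtain ⟨W, hW, hxW, -⟩ := exists_isAffineOpen_mem_and_subset (X := X) (x := x) (U := ⊤) (Opens.mem_top _)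
  haveI : IsNoetherianRing Γ(X, W) := IsLocallyNoetherian.component_noetherian ⟨W, hW⟩
  haveI : IsRegularRing Γ(X, W) := hX.isRegularRing_of_isAffineOpen hW
  set I : Ideal Γ(X, W) := J.ideal ⟨W, hW⟩ with hI
  -- `Γ(W)/J(W)` is a regular ring: `Spec` of it is an open of the regular scheme `V(J)`
  haveI : IsRegularRing (Γ(X, W) ⧸ I) := by
    have hreg : Scheme.IsRegular (Spec (J.subschemeCover.X ⟨W, hW⟩)) :=
      Scheme.IsRegular.of_isOpenImmersion (J.subschemeCover.f ⟨W, hW⟩) hY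
    exact (Scheme.isRegular_Spec_iff (.of (Γ(X, W) ⧸ I))).mp hreg
  -- the prime `𝔭` of `x` and `J(W) ⊆ 𝔭`
  have hmemD : ∀ g : Γ(X, W), x ∈ X.basicOpen g ↔ g ∉ (hW.primeIdealOf ⟨x, hxW⟩).asIdeal := by
    intro g
    rw [← PrimeSpectrum.mem_basicOpen, ← hW.fromSpec_preimage_basicOpen g]
    change _ ↔ hW.fromSpec (hW.primeIdealOf ⟨x, hxW⟩) ∈ X.basicOpen g
    rw [hW.fromSpec_primeIdealOf ⟨x, hxW⟩]
  have hIp : I ≤ (hW.primeIdealOf ⟨x, hxW⟩).asIdeal := by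
    intro f hf
    have hz := (Scheme.IdealSheafData.mem_support_iff_of_mem (I := J) (U := ⟨W, hW⟩) hxW).mp hxs
    rw [Scheme.mem_zeroLocus_iff] at hz
    by_contra hfp
    exact hz f hf ((hmemD f).mpr hfp)
  obtain ⟨g, hgp, c, f, hfI, hloc⟩ := exists_isQuasiRegular_away_of_isRegularRing I _ hIp
  have hxg : x ∈ X.basicOpen g := (hmemD g).mpr hgp
  set V : X.Opens := X.basicOpen g with hV
  have hVaff : IsAffineOpen V := hW.basicOpen g
  haveI : IsAffine (V : Scheme.{u}) := hVaff
  -- `Γ(V, ⊤)` as an `Γ(X, W)`-algebra: a localisation away from `g`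
  have hle : V.ι ''ᵁ ⊤ ≤ W := by rw [Scheme.Opens.ι_image_top]; exact X.basicOpen_le g
  letI alg : Algebra Γ(X, W) Γ((V : Scheme.{u}), ⊤) :=
    (X.presheaf.map (homOfLE hle).op).hom.toAlgebra
  haveI hlocV : IsLocalization.Away g Γ((V : Scheme.{u}), ⊤) := by
    haveI := hW.isLocalization_basicOpen g
    refine IsLocalization.isLocalization_of_algEquiv (Submonoid.powers g)
      (AlgEquiv.ofRingEquiv (f := V.topIso.symm.commRingCatIsoToRingEquiv) fun a => ?_)
    have hcomp : X.presheaf.map (homOfLE (X.basicOpen_le g)).op ≫ V.topIso.inv =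
        X.presheaf.map (homOfLE hle).op := by
      rw [Scheme.Opens.topIso_inv]
      exact ((X.presheaf.map_comp _ _).symm.trans (by rfl))
    exact congrArg (fun φ : Γ(X, W) ⟶ Γ((V : Scheme.{u}), ⊤) => φ.hom a) hcomp
  obtain ⟨hIL, hqr, -, -⟩ := hloc Γ((V : Scheme.{u}), ⊤)
  have hJV : (J.comap V.ι).ideal ⟨⊤, isAffineOpen_top _⟩ =
      Ideal.span (Set.range (algebraMap Γ(X, W) Γ((V : Scheme.{u}), ⊤) ∘ f)) := by
    rw [← hIL, Scheme.IdealSheafData.ideal_comap_of_isOpenImmersion, Scheme.Opens.ι_appIso,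
      Iso.refl_inv]
    have hWV : J.ideal ⟨V.ι ''ᵁ ⊤, (isAffineOpen_top (V : Scheme.{u})).image_of_isOpenImmersion V.ι⟩ =
        I.map (X.presheaf.map (homOfLE hle).op).hom :=
      (J.map_ideal (U := ⟨V.ι ''ᵁ ⊤, _⟩) (V := ⟨W, hW⟩) hle).symm
    rw [hWV]
    change (I.map _).comap (RingHom.id _) = _
    rw [Ideal.comap_id]
    rfl
  exact ⟨V, hVaff, hxg, c, _, hJV, hqr⟩

/-! ## The affine piece of the exceptional divisor over a chart of the centre -/

section Piece

variable {X' X : Scheme.{u}} {π : X' ⟶ X} {D : Closeds X}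

/-- **One piece.** Over an affine open `V` of `X` on which the (reduced) ideal `𝓘_D` of the irreducible closed subset
`D` is generated by a quasi-regular sequence `x₀, …, xₙ` (at least one generator), for a blowing up `π` along `𝓘_D`:
the piece `π⁻¹(D) ∩ π⁻¹(V)` of the exceptional divisor is IRREDUCIBLE (it is the image of `ℙⁿ_{Γ(D ∩ V)}`, `Γ(D ∩ V)`
a domain) as soon as `V` meets `D`, and it maps ONTO `D ∩ V` (as `ℙⁿ_R → Spec R` is surjective).
[cite: Liu2002, Thm. 8.1.19 (b)] -/
theorem IsBlowup.isIrreducible_preimage_inter_and_surjOn (hirr : IsIrreducible (D : Set X))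
    (hπ : IsBlowup π (Scheme.IdealSheafData.vanishingIdeal D)) (V : X.Opens) (hV : IsAffineOpen V)
    (hVD : ((D : Set X) ∩ V).Nonempty) {n : ℕ} (f : Fin (n + 1) → Γ((V : Scheme.{u}), ⊤))
    (hf : ((Scheme.IdealSheafData.vanishingIdeal D).comap V.ι).ideal ⟨⊤, @isAffineOpen_top (V : Scheme.{u}) hV⟩ =
      Ideal.span (Set.range f))
    (hqr : IsQuasiRegular f) :
    IsIrreducible (π ⁻¹' (D : Set X) ∩ (π ⁻¹ᵁ V : Set X')) ∧
      Set.SurjOn π (π ⁻¹' (D : Set X) ∩ (π ⁻¹ᵁ V : Set X')) ((D : Set X) ∩ V) := by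
  classical
  haveI : IsAffine (V : Scheme.{u}) := hV
  set J := Scheme.IdealSheafData.vanishingIdeal D with hJ
  -- the restricted blow-up `π|_V : π⁻¹V → V` and the centre `B = V(J|_V) ↪ V`
  set JV : (V : Scheme.{u}).IdealSheafData := J.comap V.ι with hJV
  have hβblow : IsBlowup (π ∣_ V) JV.subschemeι.ker := by
    rw [Scheme.IdealSheafData.ker_subschemeι]; exact hπ.restrict V
  have hgen : Ideal.span (Set.range f) = JV.subschemeι.ker.ideal ⟨⊤, isAffineOpen_top _⟩ := by
    rw [Scheme.IdealSheafData.ker_subschemeι, ← hf]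
  obtain ⟨φ, hφ⟩ := exists_iso_pullback_proj_of_isQuasiRegular hβblow f hgen hqr
  -- `B = D ∩ V` with its reduced structure is an integral affine scheme, so `Γ(B, ⊤)` is a domain
  have hJVeq : JV = Scheme.IdealSheafData.vanishingIdeal (D.preimage V.ι.continuous) := by
    rw [hJV, hJ]
    exact comap_vanishingIdeal_of_isOpenImmersion V.ι D
  have hirrB : IsIrreducible ((D.preimage V.ι.continuous : Closeds (V : Scheme.{u})) : Set (V : Scheme.{u})) := by
    rw [Closeds.coe_preimage]
    refine ⟨?_, hirr.isPreirreducible.preimage V.ι.isOpenEmbedding⟩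
    obtain ⟨d, hdD, hdV⟩ := hVD
    exact ⟨⟨d, hdV⟩, hdD⟩
  haveI : IsIntegral JV.subscheme := by
    rw [hJVeq]; exact ComponentGluing.isIntegral_subscheme_vanishingIdeal _ hirrB
  haveI : IsAffine JV.subscheme := isAffine_of_isAffineHom JV.subschemeι
  haveI : IrreducibleSpace (Proj (grading (Fin (n + 1)) Γ(JV.subscheme, ⊤))) :=
    irreducibleSpace_proj_mvPolynomial _ n
  -- `π` on the open `π⁻¹V` is `V.ι ∘ (π|_V)`
  have hππ : ∀ v' : (π ⁻¹ᵁ V : Scheme.{u}), π ((π ⁻¹ᵁ V).ι v') = V.ι ((π ∣_ V) v') := by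
    intro v'
    rw [← Scheme.Hom.comp_apply, ← Scheme.Hom.comp_apply, morphismRestrict_ι]
  have hmemJ : ∀ v : (V : Scheme.{u}), v ∈ JV.support ↔ V.ι v ∈ (D : Set X) := by
    intro v
    rw [hJV, Scheme.IdealSheafData.support_comap]
    show V.ι v ∈ J.support ↔ _
    rw [← SetLike.mem_coe, hJ, Scheme.IdealSheafData.coe_support_vanishingIdeal]
  -- the piece is the image of the pullback `π⁻¹V ×_V B ≅ ℙⁿ`
  set emb : pullback (π ∣_ V) JV.subschemeι ⟶ X' := pullback.fst (π ∣_ V) JV.subschemeι ≫ (π ⁻¹ᵁ V).ι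
    with hemb
  have hrange : Set.range emb = π ⁻¹' (D : Set X) ∩ (π ⁻¹ᵁ V : Set X') := by
    rw [hemb, Scheme.Hom.comp_base, TopCat.coe_comp, Set.range_comp, Scheme.Pullback.range_fst]
    ext x'
    constructor
    · rintro ⟨v', hv', rfl⟩
      have hv'' : (π ∣_ V) v' ∈ JV.support := by
        obtain ⟨b, hb⟩ := hv'
        rw [← hb, ← SetLike.mem_coe, ← Scheme.IdealSheafData.range_subschemeι]
        exact ⟨b, rfl⟩
      refine ⟨?_, ?_⟩
      · show π ((π ⁻¹ᵁ V).ι v') ∈ (D : Set X)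
        rw [hππ]
        exact (hmemJ _).mp hv''
      · have : (π ⁻¹ᵁ V).ι v' ∈ Set.range (π ⁻¹ᵁ V).ι := ⟨v', rfl⟩
        rwa [Scheme.Opens.range_ι] at this
    · rintro ⟨hx'D, hx'V⟩
      refine ⟨⟨x', hx'V⟩, ?_, rfl⟩
      have h1 : (π ∣_ V) ⟨x', hx'V⟩ ∈ JV.support := by
        rw [hmemJ, ← hππ]
        exact hx'D
      rw [← SetLike.mem_coe, ← Scheme.IdealSheafData.range_subschemeι] at h1
      exact h1
  refine ⟨?_, ?_⟩
  · -- irreducible: continuous image of `ℙⁿ_{Γ(B)}`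
    rw [← hrange, ← Set.image_univ]
    refine IsIrreducible.image ?_ _ emb.continuous.continuousOn
    have huniv : (Set.univ : Set ↥(pullback (π ∣_ V) JV.subschemeι)) = φ.inv '' Set.univ := by
      rw [Set.image_univ, eq_comm, Set.range_eq_univ]
      intro e
      refine ⟨φ.hom e, ?_⟩
      rw [← Scheme.Hom.comp_apply, Iso.hom_inv_id]
      simp
    rw [huniv]
    exact (IrreducibleSpace.isIrreducible_univ _).image _ φ.inv.continuous.continuousOn
  · -- onto `D ∩ V`: `pullback.snd` is surjective because `ℙⁿ_R → Spec R` is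
    have hsnd : Function.Surjective (pullback.snd (π ∣_ V) JV.subschemeι) := by
      intro b
      obtain ⟨q, hq⟩ := toSpec_surjective Γ(JV.subscheme, ⊤) n (JV.subscheme.toSpecΓ b)
      refine ⟨φ.inv q, ?_⟩
      have h1 : (pullback.snd (π ∣_ V) JV.subschemeι ≫ JV.subscheme.toSpecΓ) (φ.inv q) =
          JV.subscheme.toSpecΓ b := by
        rw [← hφ, Scheme.Hom.comp_apply]
        have h2 : φ.hom (φ.inv q) = q := by
          rw [← Scheme.Hom.comp_apply, Iso.inv_hom_id]; simp
        rw [h2]; exact hq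
      rw [Scheme.Hom.comp_apply] at h1
      exact (ConcreteCategory.bijective_of_isIso JV.subscheme.toSpecΓ.base).1 h1
    intro d hd
    obtain ⟨hdD, hdV⟩ := hd
    have hvs : (⟨d, hdV⟩ : ↥(V : Scheme.{u})) ∈ Set.range JV.subschemeι := by
      rw [Scheme.IdealSheafData.range_subschemeι]
      exact (hmemJ _).mpr hdD
    obtain ⟨b, hb⟩ := hvs
    obtain ⟨e, he⟩ := hsnd b
    refine ⟨emb e, by rw [← hrange]; exact ⟨e, rfl⟩, ?_⟩
    rw [hemb, Scheme.Hom.comp_apply, hππ, ← Scheme.Hom.comp_apply (pullback.fst _ _) (π ∣_ V),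
      pullback.condition, Scheme.Hom.comp_apply, he, hb]
    rfl

end Piece

/-! ## The theorem -/

/-- **Liu, Thm. 8.1.19 (b), irreducibility: the exceptional divisor `E = π⁻¹(D)` of the blowing up of a regular locally
Noetherian scheme `X` along (the reduced ideal sheaf of) a closed subset `D` that is IRREDUCIBLE, NOWHERE DENSE and
whose reduced induced subscheme is REGULAR, is irreducible** — for every morphism `π : X' → X` with the universal
property of the blowing up along `𝓘_D`. («`E` is a projective bundle … over `Y`»: locally over the centre `E` is
`ℙⁿ_{Γ(D ∩ V)}`, `n + 1 =` the number of local generators, `≥ 1` as `D` is nowhere dense; these pieces are irreducible,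
map onto `D ∩ V`, and all contain the fibre over the generic point of `D`, so `E` is the closure of any one of them.)
[cite: Liu2002, Thm. 8.1.19 (b)] -/
theorem IsBlowup.isIrreducible_preimage_of_isRegular {X' X : Scheme.{u}} {π : X' ⟶ X} [IsLocallyNoetherian X]
    (hX : Scheme.IsRegular X) {D : Closeds X}
    (hD : Scheme.IsRegular (Scheme.IdealSheafData.vanishingIdeal D).subscheme)
    (hirr : IsIrreducible (D : Set X)) (hint : interior (D : Set X) = ∅)
    (hπ : IsBlowup π (Scheme.IdealSheafData.vanishingIdeal D)) : IsIrreducible (π ⁻¹' (D : Set X)) := by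
  classical
  set J := Scheme.IdealSheafData.vanishingIdeal D with hJ
  -- generic point of `D`
  obtain ⟨η, hη⟩ := QuasiSober.sober hirr D.isClosed
  -- the local data at a point of `D`: an affine `V ∋ x` with `n + 1 ≥ 1` quasi-regular generators
  have hdata : ∀ x ∈ (D : Set X), ∃ (V : X.Opens) (hV : IsAffineOpen V), x ∈ V ∧
      ∃ (n : ℕ) (f : Fin (n + 1) → Γ((V : Scheme.{u}), ⊤)),
        (J.comap V.ι).ideal ⟨⊤, @isAffineOpen_top (V : Scheme.{u}) hV⟩ = Ideal.span (Set.range f) ∧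
          IsQuasiRegular f := by
    intro x hx
    have hxs : x ∈ J.support := by
      rw [← SetLike.mem_coe, hJ, Scheme.IdealSheafData.coe_support_vanishingIdeal]; exact hx
    obtain ⟨V, hV, hxV, c, f, hf, hqr⟩ := exists_affineOpen_isQuasiRegular_of_mem_support hX hD hxs
    -- `c ≥ 1`: otherwise `J|_V = 0`, i.e. `V ⊆ D`, contradicting nowhere-density
    cases c with
    | zero =>
      exfalso
      haveI : IsAffine (V : Scheme.{u}) := hV
      have h0 : (J.comap V.ι).ideal ⟨⊤, isAffineOpen_top _⟩ = ⊥ := by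
        rw [hf]
        simp
      have hVD : (V : Set X) ⊆ (D : Set X) := by
        intro y hy
        have hy' : (⟨y, hy⟩ : ↥(V : Scheme.{u})) ∈ (J.comap V.ι).support :=
          (Scheme.IdealSheafData.mem_support_iff_of_mem (I := J.comap V.ι) (U := ⟨⊤, isAffineOpen_top _⟩)
            (x := (⟨y, hy⟩ : ↥(V : Scheme.{u}))) (Opens.mem_top _)).mpr (by rw [h0]; simp)
        rw [Scheme.IdealSheafData.support_comap] at hy'
        have : V.ι ⟨y, hy⟩ ∈ J.support := hy'
        rw [← SetLike.mem_coe, hJ, Scheme.IdealSheafData.coe_support_vanishingIdeal] at this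
        simpa using this
      have : x ∈ interior (D : Set X) := interior_mono hVD (by rw [V.isOpen.interior_eq]; exact hxV)
      rw [hint] at this
      exact this
    | succ n => exact ⟨V, hV, hxV, n, f, hf, hqr⟩
  -- a fixed piece through a point `x₀ ∈ D`
  obtain ⟨x₀, hx₀⟩ := hirr.nonempty
  obtain ⟨V₀, hV₀, hx₀V₀, n₀, f₀, hf₀, hqr₀⟩ := hdata x₀ hx₀
  have hpiece₀ := hπ.isIrreducible_preimage_inter_and_surjOn hirr V₀ hV₀ ⟨x₀, hx₀, hx₀V₀⟩ f₀ hf₀ hqr₀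
  set S₀ := π ⁻¹' (D : Set X) ∩ (π ⁻¹ᵁ V₀ : Set X') with hS₀
  -- `E ⊆ closure S₀`
  have hEcl : π ⁻¹' (D : Set X) ⊆ closure S₀ := by
    intro e he
    obtain ⟨V, hV, hxV, n, f, hf, hqr⟩ := hdata (π e) he
    obtain ⟨hSirr, hSsurj⟩ := hπ.isIrreducible_preimage_inter_and_surjOn hirr V hV ⟨π e, he, hxV⟩ f hf hqr
    -- the generic point `η` lies in `V` and in `V₀`; a point of the piece over `η` lies in `S₀`
    have hηV : η ∈ V := (hη.mem_open_set_iff V.isOpen).mpr ⟨π e, he, hxV⟩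
    have hηV₀ : η ∈ V₀ := (hη.mem_open_set_iff V₀.isOpen).mpr ⟨x₀, hx₀, hx₀V₀⟩
    obtain ⟨e', he'S, he'η⟩ := hSsurj ⟨hη.mem, hηV⟩
    have hne : ((π ⁻¹' (D : Set X) ∩ (π ⁻¹ᵁ V : Set X')) ∩ (π ⁻¹ᵁ V₀ : Set X')).Nonempty :=
      ⟨e', he'S, show π e' ∈ V₀ by rw [he'η]; exact hηV₀⟩
    have hsub : π ⁻¹' (D : Set X) ∩ (π ⁻¹ᵁ V : Set X') ⊆ closure S₀ := by
      refine (subset_closure_inter_of_isPreirreducible_of_isOpen hSirr.isPreirreducible (π ⁻¹ᵁ V₀).isOpen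
        hne).trans (closure_mono ?_)
      rintro y ⟨⟨hyD, -⟩, hyV₀⟩
      exact ⟨hyD, hyV₀⟩
    exact hsub ⟨he, hxV⟩
  -- `E` is closed and contains `S₀`, so `E = closure S₀`, irreducible
  have hEclosed : IsClosed (π ⁻¹' (D : Set X)) := D.isClosed.preimage π.continuous
  have hEeq : π ⁻¹' (D : Set X) = closure S₀ :=
    le_antisymm hEcl (hEclosed.closure_subset_iff.mpr Set.inter_subset_left)
  rw [hEeq]
  exact hpiece₀.1.closure

end Literature.AlgebraicGeometry.Resolution

end
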